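/-
Copyright: the b2b-balaban T⁴-continuum CRUX team, row NE7b OWNER lineage `t4-ne7b-p1` (gen 144). Project licence.
-/
import Summits.QuantumFields.BalabanUV.T4Continuum.Spine.NE7b.SupFifthCumulantRowLetterTilted
import Summits.QuantumFields.BalabanUV.T4Continuum.Spine.NE7b.SupFifthFormGroupFive
import Summits.QuantumFields.BalabanUV.T4Continuum.Spine.NE7b.SupHessFourthCumulantRowLettersTilted
import Summits.QuantumFields.BalabanUV.T4Continuum.Spine.NE7b.SupFifthKernelSums
import Summits.QuantumFields.BalabanUV.T4Continuum.Spine.NE7b.SupFifthKernelPermutations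

/-!
# THE ORDER-FIVE KERNEL LETTER, GROUP FIVE (SCOPING (d15′)(vi)): for `Γ = AAᵀ` and the row index `x` carried by the
# differentiation direction, the quadruple row sums `Σ_{y,z,t,s} |d∕dσ G_i(ψ + σe_x)[e_y,e_z,e_t,e_s]|_{σ=0}` of the fifth group of
# (521)'s centred display of `∂⁴W` — `u₄(U′y,U′z,U′t,U′s)` — is bounded by the input's letters: (594) gives the derivative as 4 + 1 placements of
# the order-5 display; every placement is a piece file's row letter ((579) ×4; (578) `u₅`) after a reindexing of `(y,z,t,s)` ((595) `sum4_*`) and,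
# where the tilt factor `A_x = U′(·)e_x`
# is not in front, an integrand permutation ((596) `u4_rowsum_*`, `u5_rowsum_cyc`) — all by unification, pattern of (523)
# (row NE7b, node U5c; (578) (579) (594) (595) (596) BY NAME; [folklore]; Gross 1979 ∕ Künsch 1982 territory)

Cell `pub-balaban`, sub-cell `t4`, spine estimate NE7b (`T4WeightBudget.RelWeightBound`; the cell's OWN estimate — NOT PRINTED in
[Bałaban 1983–89], NOT PROVED).  Crux-route work under `Spine/NE7b/` by the row OWNER (`t4-ne7b-p1` gen 144, file (599)) under FREEZE
(0)'s crux-prover clause; NOTHING of Bałaban's is named as a Lean object, valued or asserted; no `T4Continuum/Support` leaf typed; no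
`def`, no notation (the group functions WRITTEN OUT as in (521)∕(591)–(594); the derivative values never restated — `deriv` of the group
function, rewritten by the group theorem inside the proof); zero `sorry`.

WHAT IS PROVED ([folklore]): **`fifth_kernel_group_u4`**, `hasDerivAt_sum33` (re-association helper for THE END); toy.

HONEST (what this is NOT).  Group five only; THE END (the order-5 kernel letter) is the next file.  The GEOMETRY letters (weights `θ, σ, ρ, r`, the
admissible `D`, the site letters `S, S′, S₁`, the support counts `n, n₃`; `αr, αc`) stay letters ((476)∕(485)∕(510)∕(561) supply them for the
road's finite-range factor).  Scalar skeleton ((A3), NC-NE7b-α UNRULED); nothing of Bałaban's asserted.  BY-NAME EFFECT ON THE WALL: NONE.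
NE7b NOT PRINTED ∕ NOT PROVED; spine PROVED 0∕9; rung (B)+1 — the programme's measures remain FINITE-torus statements; NOT the mass gap, NOT
Clay.  HONEST DEPENDENCY: continuum YM on T⁴ ⇐ BetaPertH ∧ nine spine estimates (0∕9 proved); BetaPertH ⇐ (D1) ∧ (D4) ∧ CAP+tail; G-an2-4
gates asym, D1 and NE2∕3∕4.
-/

set_option autoImplicit false
set_option maxSynthPendingDepth 4

noncomputable section

namespace Summit.QuantumFields.BalabanUV.T4Continuum.NE7b.SupFifthKernelGroupFive

open MeasureTheory ProbabilityTheory Finset Real Matrix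
open scoped BigOperators Matrix
open SupEffectiveActionDerivative (mul_opBound_le_of_le)
open SupWhitenedMomentLetters (posSemidef_AAT)
open SupFifthCumulantRowLetterTilted (fifth_cumulant_row_letter_tilted)
open SupFifthFormGroupFive (hasDerivAt_display4_u4_line)
open SupHessFourthCumulantRowLettersTilted (hess_fourth_cumulant_row_letter_tilted)
open SupFifthKernelSums (sum4_abs_split_u4 sum4_syzt sum4_tyzs sum4_zyts)
open SupFifthKernelPermutations (u4_rowsum_3124 u4_rowsum_cyc u4_rowsum_swap12 u5_rowsum_cyc)

variable {ι κ : Type} [Fintype ι] [DecidableEq ι] [Fintype κ] [DecidableEq κ]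

variable {U : EuclideanSpace ℝ ι → ℝ} {U' : EuclideanSpace ℝ ι → EuclideanSpace ℝ ι →L[ℝ] ℝ}
  {U'' : EuclideanSpace ℝ ι → EuclideanSpace ℝ ι →L[ℝ] EuclideanSpace ℝ ι →L[ℝ] ℝ}
  {U₃ : EuclideanSpace ℝ ι → EuclideanSpace ℝ ι →L[ℝ] EuclideanSpace ℝ ι →L[ℝ] EuclideanSpace ℝ ι →L[ℝ] ℝ}
  {U₄ : EuclideanSpace ℝ ι → EuclideanSpace ℝ ι →L[ℝ] EuclideanSpace ℝ ι →L[ℝ] EuclideanSpace ℝ ι →L[ℝ] EuclideanSpace ℝ ι →L[ℝ] ℝ}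
  {U₅ : EuclideanSpace ℝ ι →
    EuclideanSpace ℝ ι →L[ℝ] EuclideanSpace ℝ ι →L[ℝ] EuclideanSpace ℝ ι →L[ℝ] EuclideanSpace ℝ ι →L[ℝ] EuclideanSpace ℝ ι →L[ℝ] ℝ}
  {Hk : ι → ι → ℝ} {K3 : ι → ι → ι → ℝ} {K4 : ι → ι → ι → ι → ℝ} {K5 : ι → ι → ι → ι → ι → ℝ} {A : Matrix ι κ ℝ} {D : κ → κ → ℝ}
  {γop κ₀ κ₁ κ₂ κ₃ κ₄ κ₅ κ₅r a τ δ θp lam lamA αr αc hr hc k3r k3c k4r k4c k5r k5c γ dr dc dθ dθ' αθ βθ S S' S₁ n₃ : ℝ} {θ : κ → κ → ℝ}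
  {σ : ι → κ → ℝ} {ρ r : ι → ι → ℝ} {n : ℕ}

set_option synthInstance.maxHeartbeats 200000 in
set_option maxHeartbeats 400000 in
/-- **Group five (the `u₄` group)**: the row letter of the differentiated `u₄(U′y,U′z,U′t,U′s)` — four `u₄(U″x·,U′,U′,U′)` placements ((579), three
after a permutation of the observables) and `u₅` ((578), after the cyclic permutation bringing `U′x` to the front). [folklore] -/
theorem fifth_kernel_group_u4 [Nonempty κ]
    (hΓop : (γop • (1 : Matrix ι ι ℝ) - A * Aᵀ).PosSemidef) (Y : Finset ι) (hUd : ∀ φ : EuclideanSpace ℝ ι, HasFDerivAt U (U' φ) φ)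
    (hU'd : ∀ φ : EuclideanSpace ℝ ι, HasFDerivAt U' (U'' φ) φ) (hU''d : ∀ φ : EuclideanSpace ℝ ι, HasFDerivAt U'' (U₃ φ) φ)
    (hU₃d : ∀ φ : EuclideanSpace ℝ ι, HasFDerivAt U₃ (U₄ φ) φ) (hκ₀ : 0 ≤ κ₀) (hκ₁ : 0 ≤ κ₁) (ha : 0 ≤ a) (hτ : 0 < τ) (hδ : 0 < δ) (hθ0 : 0 < θp)
    (hθ1 : θp < 1) (hκθ : (2 * κ₀ * (1 + τ) + 4 * δ) * γop ≤ θp) (hκθw : 2 * κ₀ * (1 + τ) * γop + 4 * δ ≤ θp)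
    (hstab : ∀ φ : EuclideanSpace ℝ ι, -(κ₀ * ∑ x ∈ Y, φ x ^ 2) ≤ U φ) (hU'b : ∀ φ : EuclideanSpace ℝ ι, ‖U' φ‖ ≤ κ₁ * (a + ∑ x ∈ Y, φ x ^ 2))
    (hU''b : ∀ φ : EuclideanSpace ℝ ι, ‖U'' φ‖ ≤ κ₂) (hU₃b : ∀ φ : EuclideanSpace ℝ ι, ‖U₃ φ‖ ≤ κ₃) (hlam : 0 ≤ lam)
    (hUsec : ∀ s : ℝ, 0 ≤ s → s ≤ 1 → ∀ a b : EuclideanSpace ℝ ι,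
      U ((1 - s) • a + s • b) - lam / 2 * (s * (1 - s)) * ∑ i, (a i - b i) ^ 2 ≤ (1 - s) * U a + s * U b)
    (hρg : lam * γop < 1)
    (hHk : ∀ (φ : EuclideanSpace ℝ ι) (x z : ι), |U'' φ (EuclideanSpace.single z (1 : ℝ)) (EuclideanSpace.single x (1 : ℝ))| ≤ Hk x z)
    (hHk0 : ∀ v u, 0 ≤ Hk v u)
    (hK3 : ∀ (φ : EuclideanSpace ℝ ι) (u x y : ι),
      |U₃ φ (EuclideanSpace.single u (1 : ℝ)) (EuclideanSpace.single x (1 : ℝ)) (EuclideanSpace.single y (1 : ℝ))| ≤ K3 x y u)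
    (hK30 : ∀ x y u, 0 ≤ K3 x y u) (hhr : ∀ v, ∑ u, Hk v u ≤ hr) (ψ : EuclideanSpace ℝ ι) (hαr : ∀ u, ∑ w, |A u w| ≤ αr)
    (hαc : ∀ w, ∑ u, |A u w| ≤ αc) (hlamA : ∀ x : κ, ∑ u, ∑ v, |A u x| * |A v x| * Hk v u ≤ lamA) (hlamA1 : lamA < 1)
    (hγ : αc * hr * αr / (1 - lamA) ≤ γ) (hγ1 : γ < 1) (hD : ∀ x y, 0 ≤ D x y)
    (hDC : ∀ x y, (if x = y then (1 : ℝ) else 0) + ∑ z, D x z * ((if y = z then 0 else ∑ u, ∑ v, |A u y| * |A v z| * Hk v u) / (1 - lamA)) ≤ D x y)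
    (hθnn : ∀ z w, 0 ≤ θ z w) (hDθr : ∀ z, ∑ w, D z w * θ z w ≤ dθ) (hdθ : 0 ≤ dθ) (hDθc : ∀ w, ∑ z, D z w * θ z w ≤ dθ') (hdθ' : 0 ≤ dθ')
    (hσ0 : ∀ x w, 0 ≤ σ x w) (hσθ : ∀ x z w, σ x w ≤ σ x z * θ z w) (hr1 : ∀ x y, 1 ≤ r x y) (hrs : ∀ u v, r u v = r v u)
    (hrσ : ∀ x y w, r x y ^ 24 ≤ σ x w * σ y w) (haσ : ∀ v : ι, ∑ w, (∑ u, |A u w| * Hk v u) * σ v w ≤ αθ) (hβ : 0 ≤ βθ)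
    (haσ' : ∀ (v : ι) (w : κ), (∑ u, |A u w| * Hk v u) * σ v w ≤ βθ) (hgσ : ∀ p q : ι, ∑ w, (∑ u, |A u w| * K3 p q u) * σ p w ≤ αθ)
    (hgσ' : ∀ (p q : ι) (w : κ), (∑ u, |A u w| * K3 p q u) * σ p w ≤ βθ) (x : ι) (hSr : ∀ u, ∑ v, (r u v ^ 2)⁻¹ ≤ S')
    (hSc : ∀ v, ∑ u, (r u v ^ 2)⁻¹ ≤ S') (hS1 : ∀ u, ∑ v, (r u v)⁻¹ ≤ S₁) (hn : ∀ y : ι, (Finset.univ.filter (fun z => Hk z y ≠ 0)).card ≤ n) :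
    ∑ y, ∑ z, ∑ t, ∑ s, |deriv (fun σ : ℝ => (((∫ ω : EuclideanSpace ℝ ι, exp (-U (ω + (ψ + σ • EuclideanSpace.single x (1 : ℝ))))
        ∂(multivariateGaussian 0 (A * Aᵀ)))⁻¹ * (∫ ω : EuclideanSpace ℝ ι, exp (-U (ω + (ψ + σ • EuclideanSpace.single x (1 : ℝ)))) * ((U' (ω + (ψ +
        σ • EuclideanSpace.single x (1 : ℝ))) (EuclideanSpace.single y (1 : ℝ)) - ((∫ ω : EuclideanSpace ℝ ι, exp (-U (ω + (ψ + σ •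
        EuclideanSpace.single x (1 : ℝ)))) ∂(multivariateGaussian 0 (A * Aᵀ)))⁻¹ * (∫ ω : EuclideanSpace ℝ ι, exp (-U (ω + (ψ + σ •
        EuclideanSpace.single x (1 : ℝ)))) * U' (ω + (ψ + σ • EuclideanSpace.single x (1 : ℝ))) (EuclideanSpace.single y (1 : ℝ))
        ∂(multivariateGaussian 0 (A * Aᵀ))))) * (U' (ω + (ψ + σ • EuclideanSpace.single x (1 : ℝ))) (EuclideanSpace.single z (1 : ℝ)) - ((∫ ω :
        EuclideanSpace ℝ ι, exp (-U (ω + (ψ + σ • EuclideanSpace.single x (1 : ℝ)))) ∂(multivariateGaussian 0 (A * Aᵀ)))⁻¹ * (∫ ω : EuclideanSpace ℝ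
        ι, exp (-U (ω + (ψ + σ • EuclideanSpace.single x (1 : ℝ)))) * U' (ω + (ψ + σ • EuclideanSpace.single x (1 : ℝ))) (EuclideanSpace.single z (1
        : ℝ)) ∂(multivariateGaussian 0 (A * Aᵀ))))) * (U' (ω + (ψ + σ • EuclideanSpace.single x (1 : ℝ))) (EuclideanSpace.single t (1 : ℝ)) - ((∫ ω :
        EuclideanSpace ℝ ι, exp (-U (ω + (ψ + σ • EuclideanSpace.single x (1 : ℝ)))) ∂(multivariateGaussian 0 (A * Aᵀ)))⁻¹ * (∫ ω : EuclideanSpace ℝ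
        ι, exp (-U (ω + (ψ + σ • EuclideanSpace.single x (1 : ℝ)))) * U' (ω + (ψ + σ • EuclideanSpace.single x (1 : ℝ))) (EuclideanSpace.single t (1
        : ℝ)) ∂(multivariateGaussian 0 (A * Aᵀ))))) * (U' (ω + (ψ + σ • EuclideanSpace.single x (1 : ℝ))) (EuclideanSpace.single s (1 : ℝ)) - ((∫ ω :
        EuclideanSpace ℝ ι, exp (-U (ω + (ψ + σ • EuclideanSpace.single x (1 : ℝ)))) ∂(multivariateGaussian 0 (A * Aᵀ)))⁻¹ * (∫ ω : EuclideanSpace ℝ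
        ι, exp (-U (ω + (ψ + σ • EuclideanSpace.single x (1 : ℝ)))) * U' (ω + (ψ + σ • EuclideanSpace.single x (1 : ℝ))) (EuclideanSpace.single s (1
        : ℝ)) ∂(multivariateGaussian 0 (A * Aᵀ)))))) ∂(multivariateGaussian 0 (A * Aᵀ)))) - ((∫ ω : EuclideanSpace ℝ ι, exp (-U (ω + (ψ + σ •
        EuclideanSpace.single x (1 : ℝ)))) ∂(multivariateGaussian 0 (A * Aᵀ)))⁻¹ * (∫ ω : EuclideanSpace ℝ ι, exp (-U (ω + (ψ + σ •
        EuclideanSpace.single x (1 : ℝ)))) * ((U' (ω + (ψ + σ • EuclideanSpace.single x (1 : ℝ))) (EuclideanSpace.single y (1 : ℝ)) - ((∫ ω :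
        EuclideanSpace ℝ ι, exp (-U (ω + (ψ + σ • EuclideanSpace.single x (1 : ℝ)))) ∂(multivariateGaussian 0 (A * Aᵀ)))⁻¹ * (∫ ω : EuclideanSpace ℝ
        ι, exp (-U (ω + (ψ + σ • EuclideanSpace.single x (1 : ℝ)))) * U' (ω + (ψ + σ • EuclideanSpace.single x (1 : ℝ))) (EuclideanSpace.single y (1
        : ℝ)) ∂(multivariateGaussian 0 (A * Aᵀ))))) * (U' (ω + (ψ + σ • EuclideanSpace.single x (1 : ℝ))) (EuclideanSpace.single z (1 : ℝ)) - ((∫ ω :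
        EuclideanSpace ℝ ι, exp (-U (ω + (ψ + σ • EuclideanSpace.single x (1 : ℝ)))) ∂(multivariateGaussian 0 (A * Aᵀ)))⁻¹ * (∫ ω : EuclideanSpace ℝ
        ι, exp (-U (ω + (ψ + σ • EuclideanSpace.single x (1 : ℝ)))) * U' (ω + (ψ + σ • EuclideanSpace.single x (1 : ℝ))) (EuclideanSpace.single z (1
        : ℝ)) ∂(multivariateGaussian 0 (A * Aᵀ)))))) ∂(multivariateGaussian 0 (A * Aᵀ)))) * ((∫ ω : EuclideanSpace ℝ ι, exp (-U (ω + (ψ + σ •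
        EuclideanSpace.single x (1 : ℝ)))) ∂(multivariateGaussian 0 (A * Aᵀ)))⁻¹ * (∫ ω : EuclideanSpace ℝ ι, exp (-U (ω + (ψ + σ •
        EuclideanSpace.single x (1 : ℝ)))) * ((U' (ω + (ψ + σ • EuclideanSpace.single x (1 : ℝ))) (EuclideanSpace.single t (1 : ℝ)) - ((∫ ω :
        EuclideanSpace ℝ ι, exp (-U (ω + (ψ + σ • EuclideanSpace.single x (1 : ℝ)))) ∂(multivariateGaussian 0 (A * Aᵀ)))⁻¹ * (∫ ω : EuclideanSpace ℝ
        ι, exp (-U (ω + (ψ + σ • EuclideanSpace.single x (1 : ℝ)))) * U' (ω + (ψ + σ • EuclideanSpace.single x (1 : ℝ))) (EuclideanSpace.single t (1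
        : ℝ)) ∂(multivariateGaussian 0 (A * Aᵀ))))) * (U' (ω + (ψ + σ • EuclideanSpace.single x (1 : ℝ))) (EuclideanSpace.single s (1 : ℝ)) - ((∫ ω :
        EuclideanSpace ℝ ι, exp (-U (ω + (ψ + σ • EuclideanSpace.single x (1 : ℝ)))) ∂(multivariateGaussian 0 (A * Aᵀ)))⁻¹ * (∫ ω : EuclideanSpace ℝ
        ι, exp (-U (ω + (ψ + σ • EuclideanSpace.single x (1 : ℝ)))) * U' (ω + (ψ + σ • EuclideanSpace.single x (1 : ℝ))) (EuclideanSpace.single s (1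
        : ℝ)) ∂(multivariateGaussian 0 (A * Aᵀ)))))) ∂(multivariateGaussian 0 (A * Aᵀ)))) - ((∫ ω : EuclideanSpace ℝ ι, exp (-U (ω + (ψ + σ •
        EuclideanSpace.single x (1 : ℝ)))) ∂(multivariateGaussian 0 (A * Aᵀ)))⁻¹ * (∫ ω : EuclideanSpace ℝ ι, exp (-U (ω + (ψ + σ •
        EuclideanSpace.single x (1 : ℝ)))) * ((U' (ω + (ψ + σ • EuclideanSpace.single x (1 : ℝ))) (EuclideanSpace.single y (1 : ℝ)) - ((∫ ω :
        EuclideanSpace ℝ ι, exp (-U (ω + (ψ + σ • EuclideanSpace.single x (1 : ℝ)))) ∂(multivariateGaussian 0 (A * Aᵀ)))⁻¹ * (∫ ω : EuclideanSpace ℝ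
        ι, exp (-U (ω + (ψ + σ • EuclideanSpace.single x (1 : ℝ)))) * U' (ω + (ψ + σ • EuclideanSpace.single x (1 : ℝ))) (EuclideanSpace.single y (1
        : ℝ)) ∂(multivariateGaussian 0 (A * Aᵀ))))) * (U' (ω + (ψ + σ • EuclideanSpace.single x (1 : ℝ))) (EuclideanSpace.single t (1 : ℝ)) - ((∫ ω :
        EuclideanSpace ℝ ι, exp (-U (ω + (ψ + σ • EuclideanSpace.single x (1 : ℝ)))) ∂(multivariateGaussian 0 (A * Aᵀ)))⁻¹ * (∫ ω : EuclideanSpace ℝ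
        ι, exp (-U (ω + (ψ + σ • EuclideanSpace.single x (1 : ℝ)))) * U' (ω + (ψ + σ • EuclideanSpace.single x (1 : ℝ))) (EuclideanSpace.single t (1
        : ℝ)) ∂(multivariateGaussian 0 (A * Aᵀ)))))) ∂(multivariateGaussian 0 (A * Aᵀ)))) * ((∫ ω : EuclideanSpace ℝ ι, exp (-U (ω + (ψ + σ •
        EuclideanSpace.single x (1 : ℝ)))) ∂(multivariateGaussian 0 (A * Aᵀ)))⁻¹ * (∫ ω : EuclideanSpace ℝ ι, exp (-U (ω + (ψ + σ •
        EuclideanSpace.single x (1 : ℝ)))) * ((U' (ω + (ψ + σ • EuclideanSpace.single x (1 : ℝ))) (EuclideanSpace.single z (1 : ℝ)) - ((∫ ω :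
        EuclideanSpace ℝ ι, exp (-U (ω + (ψ + σ • EuclideanSpace.single x (1 : ℝ)))) ∂(multivariateGaussian 0 (A * Aᵀ)))⁻¹ * (∫ ω : EuclideanSpace ℝ
        ι, exp (-U (ω + (ψ + σ • EuclideanSpace.single x (1 : ℝ)))) * U' (ω + (ψ + σ • EuclideanSpace.single x (1 : ℝ))) (EuclideanSpace.single z (1
        : ℝ)) ∂(multivariateGaussian 0 (A * Aᵀ))))) * (U' (ω + (ψ + σ • EuclideanSpace.single x (1 : ℝ))) (EuclideanSpace.single s (1 : ℝ)) - ((∫ ω :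
        EuclideanSpace ℝ ι, exp (-U (ω + (ψ + σ • EuclideanSpace.single x (1 : ℝ)))) ∂(multivariateGaussian 0 (A * Aᵀ)))⁻¹ * (∫ ω : EuclideanSpace ℝ
        ι, exp (-U (ω + (ψ + σ • EuclideanSpace.single x (1 : ℝ)))) * U' (ω + (ψ + σ • EuclideanSpace.single x (1 : ℝ))) (EuclideanSpace.single s (1
        : ℝ)) ∂(multivariateGaussian 0 (A * Aᵀ)))))) ∂(multivariateGaussian 0 (A * Aᵀ)))) - ((∫ ω : EuclideanSpace ℝ ι, exp (-U (ω + (ψ + σ •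
        EuclideanSpace.single x (1 : ℝ)))) ∂(multivariateGaussian 0 (A * Aᵀ)))⁻¹ * (∫ ω : EuclideanSpace ℝ ι, exp (-U (ω + (ψ + σ •
        EuclideanSpace.single x (1 : ℝ)))) * ((U' (ω + (ψ + σ • EuclideanSpace.single x (1 : ℝ))) (EuclideanSpace.single y (1 : ℝ)) - ((∫ ω :
        EuclideanSpace ℝ ι, exp (-U (ω + (ψ + σ • EuclideanSpace.single x (1 : ℝ)))) ∂(multivariateGaussian 0 (A * Aᵀ)))⁻¹ * (∫ ω : EuclideanSpace ℝ
        ι, exp (-U (ω + (ψ + σ • EuclideanSpace.single x (1 : ℝ)))) * U' (ω + (ψ + σ • EuclideanSpace.single x (1 : ℝ))) (EuclideanSpace.single y (1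
        : ℝ)) ∂(multivariateGaussian 0 (A * Aᵀ))))) * (U' (ω + (ψ + σ • EuclideanSpace.single x (1 : ℝ))) (EuclideanSpace.single s (1 : ℝ)) - ((∫ ω :
        EuclideanSpace ℝ ι, exp (-U (ω + (ψ + σ • EuclideanSpace.single x (1 : ℝ)))) ∂(multivariateGaussian 0 (A * Aᵀ)))⁻¹ * (∫ ω : EuclideanSpace ℝ
        ι, exp (-U (ω + (ψ + σ • EuclideanSpace.single x (1 : ℝ)))) * U' (ω + (ψ + σ • EuclideanSpace.single x (1 : ℝ))) (EuclideanSpace.single s (1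
        : ℝ)) ∂(multivariateGaussian 0 (A * Aᵀ)))))) ∂(multivariateGaussian 0 (A * Aᵀ)))) * ((∫ ω : EuclideanSpace ℝ ι, exp (-U (ω + (ψ + σ •
        EuclideanSpace.single x (1 : ℝ)))) ∂(multivariateGaussian 0 (A * Aᵀ)))⁻¹ * (∫ ω : EuclideanSpace ℝ ι, exp (-U (ω + (ψ + σ •
        EuclideanSpace.single x (1 : ℝ)))) * ((U' (ω + (ψ + σ • EuclideanSpace.single x (1 : ℝ))) (EuclideanSpace.single z (1 : ℝ)) - ((∫ ω :
        EuclideanSpace ℝ ι, exp (-U (ω + (ψ + σ • EuclideanSpace.single x (1 : ℝ)))) ∂(multivariateGaussian 0 (A * Aᵀ)))⁻¹ * (∫ ω : EuclideanSpace ℝ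
        ι, exp (-U (ω + (ψ + σ • EuclideanSpace.single x (1 : ℝ)))) * U' (ω + (ψ + σ • EuclideanSpace.single x (1 : ℝ))) (EuclideanSpace.single z (1
        : ℝ)) ∂(multivariateGaussian 0 (A * Aᵀ))))) * (U' (ω + (ψ + σ • EuclideanSpace.single x (1 : ℝ))) (EuclideanSpace.single t (1 : ℝ)) - ((∫ ω :
        EuclideanSpace ℝ ι, exp (-U (ω + (ψ + σ • EuclideanSpace.single x (1 : ℝ)))) ∂(multivariateGaussian 0 (A * Aᵀ)))⁻¹ * (∫ ω : EuclideanSpace ℝ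
        ι, exp (-U (ω + (ψ + σ • EuclideanSpace.single x (1 : ℝ)))) * U' (ω + (ψ + σ • EuclideanSpace.single x (1 : ℝ))) (EuclideanSpace.single t (1
        : ℝ)) ∂(multivariateGaussian 0 (A * Aᵀ)))))) ∂(multivariateGaussian 0 (A * Aᵀ)))))) 0| ≤
      n * ((4 * (αθ * dθ * (βθ * dθ') / (1 - lamA)) + 3 * (αθ * dθ * (βθ * dθ') / (1 - lamA)) ^ 2 + 4 * (5 * ((κ₂ ^ 4 + κ₃ ^ 4) * γop ^ 2) / (1 - lam
          * γop) ^ 2) + 4 * (50 * ((κ₂ ^ 6 + κ₃ ^ 6) * γop ^ 3) / (1 - lam * γop) ^ 3) + 2 * (((5 * ((κ₂ ^ 4 + κ₃ ^ 4) * γop ^ 2) / (1 - lam * γop) ^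
          2) + 1) / 2) * ((((5 * ((κ₂ ^ 4 + κ₃ ^ 4) * γop ^ 2) / (1 - lam * γop) ^ 2) + 1) / 2) + (5 * ((κ₂ ^ 4 + κ₃ ^ 4) * γop ^ 2) / (1 - lam *
          γop) ^ 2))) * (16 * S' ^ 3)) +
        n * ((4 * (αθ * dθ * (βθ * dθ') / (1 - lamA)) + 3 * (αθ * dθ * (βθ * dθ') / (1 - lamA)) ^ 2 + 4 * (5 * ((κ₂ ^ 4 + κ₃ ^ 4) * γop ^ 2) / (1 -
            lam * γop) ^ 2) + 4 * (50 * ((κ₂ ^ 6 + κ₃ ^ 6) * γop ^ 3) / (1 - lam * γop) ^ 3) + 2 * (((5 * ((κ₂ ^ 4 + κ₃ ^ 4) * γop ^ 2) / (1 - lam *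
            γop) ^ 2) + 1) / 2) * ((((5 * ((κ₂ ^ 4 + κ₃ ^ 4) * γop ^ 2) / (1 - lam * γop) ^ 2) + 1) / 2) + (5 * ((κ₂ ^ 4 + κ₃ ^ 4) * γop ^ 2) / (1 -
            lam * γop) ^ 2))) * (16 * S' ^ 3)) +
        n * ((4 * (αθ * dθ * (βθ * dθ') / (1 - lamA)) + 3 * (αθ * dθ * (βθ * dθ') / (1 - lamA)) ^ 2 + 4 * (5 * ((κ₂ ^ 4 + κ₃ ^ 4) * γop ^ 2) / (1 -
            lam * γop) ^ 2) + 4 * (50 * ((κ₂ ^ 6 + κ₃ ^ 6) * γop ^ 3) / (1 - lam * γop) ^ 3) + 2 * (((5 * ((κ₂ ^ 4 + κ₃ ^ 4) * γop ^ 2) / (1 - lam *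
            γop) ^ 2) + 1) / 2) * ((((5 * ((κ₂ ^ 4 + κ₃ ^ 4) * γop ^ 2) / (1 - lam * γop) ^ 2) + 1) / 2) + (5 * ((κ₂ ^ 4 + κ₃ ^ 4) * γop ^ 2) / (1 -
            lam * γop) ^ 2))) * (16 * S' ^ 3)) +
        n * ((4 * (αθ * dθ * (βθ * dθ') / (1 - lamA)) + 3 * (αθ * dθ * (βθ * dθ') / (1 - lamA)) ^ 2 + 4 * (5 * ((κ₂ ^ 4 + κ₃ ^ 4) * γop ^ 2) / (1 -
            lam * γop) ^ 2) + 4 * (50 * ((κ₂ ^ 6 + κ₃ ^ 6) * γop ^ 3) / (1 - lam * γop) ^ 3) + 2 * (((5 * ((κ₂ ^ 4 + κ₃ ^ 4) * γop ^ 2) / (1 - lam *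
            γop) ^ 2) + 1) / 2) * ((((5 * ((κ₂ ^ 4 + κ₃ ^ 4) * γop ^ 2) / (1 - lam * γop) ^ 2) + 1) / 2) + (5 * ((κ₂ ^ 4 + κ₃ ^ 4) * γop ^ 2) / (1 -
            lam * γop) ^ 2))) * (16 * S' ^ 3)) +
        ((4 * (αθ * dθ * (βθ * dθ') / (1 - lamA)) + 5 * (50 * (κ₂ ^ 6 * γop ^ 3) / (1 - lam * γop) ^ 3) + (((5 * (κ₂ ^ 4 * γop ^ 2) / (1 - lam * γop)
            ^ 2) + 1) / 2) * (5 * (κ₂ ^ 4 * γop ^ 2) / (1 - lam * γop) ^ 2) + 2 * (αθ * dθ * (βθ * dθ') / (1 - lamA)) * ((((5 * (κ₂ ^ 4 * γop ^ 2) /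
            (1 - lam * γop) ^ 2) + 1) / 2) + (5 * (κ₂ ^ 4 * γop ^ 2) / (1 - lam * γop) ^ 2)) + 24 * (((5 * (κ₂ ^ 4 * γop ^ 2) / (1 - lam * γop) ^ 2)
            + 1) / 2) * Real.sqrt ((αθ * dθ * (βθ * dθ') / (1 - lamA)) * (5 * (κ₂ ^ 4 * γop ^ 2) / (1 - lam * γop) ^ 2))) + (6 * (αθ * dθ * (βθ *
            dθ') / (1 - lamA)) + 5 * (50 * (κ₂ ^ 6 * γop ^ 3) / (1 - lam * γop) ^ 3) + ((((5 * (κ₂ ^ 4 * γop ^ 2) / (1 - lam * γop) ^ 2) + 1) / 2) +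
            (5 * (κ₂ ^ 4 * γop ^ 2) / (1 - lam * γop) ^ 2)) ^ 2 / 2 + 3 * (((5 * (κ₂ ^ 4 * γop ^ 2) / (1 - lam * γop) ^ 2) + 1) / 2) * (5 * (κ₂ ^ 4 *
            γop ^ 2) / (1 - lam * γop) ^ 2) + 3 * (αθ * dθ * (βθ * dθ') / (1 - lamA)) * ((((5 * (κ₂ ^ 4 * γop ^ 2) / (1 - lam * γop) ^ 2) + 1) / 2) +
            (5 * (κ₂ ^ 4 * γop ^ 2) / (1 - lam * γop) ^ 2)) + 12 * (((5 * (κ₂ ^ 4 * γop ^ 2) / (1 - lam * γop) ^ 2) + 1) / 2) * Real.sqrt ((αθ * dθ *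
            (βθ * dθ') / (1 - lamA)) * (5 * (κ₂ ^ 4 * γop ^ 2) / (1 - lam * γop) ^ 2)))) * (576 * S₁ ^ 4) := by
  have hΓ : (A * Aᵀ).PosSemidef := posSemidef_AAT A
  have hU''c : Continuous U'' := continuous_iff_continuousAt.2 fun φ => (hU''d φ).continuousAt
  have hU₃c : Continuous U₃ := continuous_iff_continuousAt.2 fun φ => (hU₃d φ).continuousAt
  -- the group's derivative, entry by entry (`hasDerivAt_display4_u4_line`)
  apply Eq.trans_le
  · exact Finset.sum_congr rfl fun y _ => Finset.sum_congr rfl fun z _ => Finset.sum_congr rfl fun t _ => Finset.sum_congr rfl fun s _ =>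
      congrArg abs (hasDerivAt_display4_u4_line hΓ hΓop Y hUd hU'd hU''c hκ₀ hκ₁ ha hτ hδ hθ0 hθ1 hκθ hstab hU'b hU''b ψ (EuclideanSpace.single x (1
          : ℝ)) (EuclideanSpace.single y (1 : ℝ)) (EuclideanSpace.single z (1 : ℝ)) (EuclideanSpace.single t (1 : ℝ)) (EuclideanSpace.single s (1 :
          ℝ))).deriv
  -- the placements' row letters (pieces BY NAME; reindexed by (595), `x`-factor to the front by (596))
  have h1 := hess_fourth_cumulant_row_letter_tilted hΓop Y hUd hU'd hU''d hU₃c hκ₀ hκ₁ ha hτ hδ hθ0 hθ1 hκθ hκθw hstab hU'b hU''b hU₃b hlam hUsec hρg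
      hHk hHk0 hK3 hK30 ψ hαr hαc hhr hlamA hlamA1 hγ hγ1 hD hDC hθnn hDθr hdθ hDθc hdθ' hσ0 hσθ hr1 hrσ haσ hβ haσ' hgσ hgσ' hSr hSc x (hn x)
  have h2 := ((u4_rowsum_swap12 _ _ _ _ _ _ _ _ _ _ _).trans_le ((sum4_zyts _).trans_le (hess_fourth_cumulant_row_letter_tilted hΓop Y hUd hU'd hU''d
      hU₃c hκ₀ hκ₁ ha hτ hδ hθ0 hθ1 hκθ hκθw hstab hU'b hU''b hU₃b hlam hUsec hρg hHk hHk0 hK3 hK30 ψ hαr hαc hhr hlamA hlamA1 hγ hγ1 hD hDC hθnn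
      hDθr hdθ hDθc hdθ' hσ0 hσθ hr1 hrσ haσ hβ haσ' hgσ hgσ' hSr hSc x (hn x))))
  have h3 := ((u4_rowsum_3124 _ _ _ _ _ _ _ _ _ _ _).trans_le ((sum4_tyzs _).trans_le (hess_fourth_cumulant_row_letter_tilted hΓop Y hUd hU'd hU''d
      hU₃c hκ₀ hκ₁ ha hτ hδ hθ0 hθ1 hκθ hκθw hstab hU'b hU''b hU₃b hlam hUsec hρg hHk hHk0 hK3 hK30 ψ hαr hαc hhr hlamA hlamA1 hγ hγ1 hD hDC hθnn
      hDθr hdθ hDθc hdθ' hσ0 hσθ hr1 hrσ haσ hβ haσ' hgσ hgσ' hSr hSc x (hn x))))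
  have h4 := ((u4_rowsum_cyc _ _ _ _ _ _ _ _ _ _ _).trans_le ((sum4_syzt _).trans_le (hess_fourth_cumulant_row_letter_tilted hΓop Y hUd hU'd hU''d
      hU₃c hκ₀ hκ₁ ha hτ hδ hθ0 hθ1 hκθ hκθw hstab hU'b hU''b hU₃b hlam hUsec hρg hHk hHk0 hK3 hK30 ψ hαr hαc hhr hlamA hlamA1 hγ hγ1 hD hDC hθnn
      hDθr hdθ hDθc hdθ' hσ0 hσθ hr1 hrσ haσ hβ haσ' hgσ hgσ' hSr hSc x (hn x))))
  have h5 := ((u5_rowsum_cyc _ _ _ _ _ _ _ _ _ _ _ _ _).trans_le (fifth_cumulant_row_letter_tilted hΓop Y hUd hU'd hU''c hκ₀ hκ₁ ha hτ hδ hθ0 hθ1 hκθ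
      hκθw hstab hU'b hU''b hlam hUsec hρg hHk hHk0 ψ hαr hαc hhr hlamA hlamA1 hγ hγ1 hD hDC hθnn hDθr hdθ hDθc hdθ' hσ0 hσθ hr1 hrσ haσ hβ haσ' hrs
      hS1 x))
  beta_reduce at h2 h3 h4 h5
  -- assemble
  refine (sum4_abs_split_u4 _ _ _ _ _).trans ?_
  have hsum := add_le_add (add_le_add (add_le_add (add_le_add h1 h2) h3) h4) h5
  exact hsum.trans (le_of_eq (by ring))

omit [Fintype ι] [DecidableEq ι] [Fintype κ] [DecidableEq κ] in
/-- For THE END (next file): (592) differentiates `κ₃ᶜ₁ + κ₃ᶜ₂ + κ₃ᶜ₃` and (593) `κ₃ᶜ₄ + κ₃ᶜ₅ + κ₃ᶜ₆`, while (521)'s display carries the six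
centred triples as ONE left-associated sum; this re-associates the two `HasDerivAt`s. [folklore] -/
theorem hasDerivAt_sum33 {f₁ f₂ f₃ f₄ f₅ f₆ : ℝ → ℝ} {a b x : ℝ} (hA : HasDerivAt (fun σ => f₁ σ + f₂ σ + f₃ σ) a x)
    (hB : HasDerivAt (fun σ => f₄ σ + f₅ σ + f₆ σ) b x) :
    HasDerivAt (fun σ => f₁ σ + f₂ σ + f₃ σ + f₄ σ + f₅ σ + f₆ σ) (a + b) x :=
  (hA.add hB).congr_of_eventuallyEq (Filter.Eventually.of_forall fun σ => by simp only [Pi.add_apply]; ring)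

/-! ## Toy -/

/-- Toy (the assembly's arithmetic): four equal `u₄` letters and the `u₅` letter collect. -/
example (L L' : ℝ) : L + L + L + L + L' = 4 * L + L' := by ring

end Summit.QuantumFields.BalabanUV.T4Continuum.NE7b.SupFifthKernelGroupFive

end
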